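import Summits.QuantumFields.YangMills.Theorems.BalabanUVNodesN15CurvedGluingCubeSmoothCutDressedAdjointRowSandwich
import HarnessLib

/-!
# THE ADJOINT-SIDE CUBE's ENTRY-2 SANDWICH FOR A COVARIANT-SHAPED RIGHT ENTRY `M_R∘∇^± + M_B` (the print's `∇^{U*}`: transport `R`, connection part `B`): `G∘(M_R∇^± + M_B)∘M_χ = T₂∘M_χ` with
# `T₂ = T^±∘M_{R∘e^∓} − G∘M_{∇R} + G∘M_B` from the pure-gradient sandwich `G∘∇^±∘M_χ = T^±∘M_χ`; sums over directions; the cut form FILE 149∕158 consume; `T₂`'s two-sided row and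
# two-grid η-defect from the rows∕defects of `G, T^±` and the coefficients' row sums∕fits (dag-n15-c g18, FILE 157; N15 = NE2, s1 «background-layer OPERATOR ingredient»)

Cell `pub-ymgap`, seat `pub-ymgap-dag-n15-c` (R134 (a); HUMAN RULING D-0062), generation 18.  `bears_on: R4∕N15 · K3⁸ SpineGivenEndpointR13SepCoPHV (stmt-QuantumFields-27366)`.
Filed `--kind proof --supports stmt-QuantumFields-27366 --as helper` — COUNT-NEUTRAL.  Theorems only; 0 `def`, 0 `sorry`.  Imports BY NAME FILE 153 `…CubeSmoothCutDressedAdjointRowSandwich`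
(`comp_mulOp_of_sandwich`, `smoothCutDressed_comp_grad_sandwich`) and through it FILE 150 (`comp_species_fgrad_sandwich`, `comp_species_bgrad_sandwich`, `mmulOp_comp_fgrad_eq`,
`mmulOp_comp_bgrad_eq`), dag-n15-w3 `mmulOp_comp_mulOp_fst`, `hasMaj_comp_mmulOp_loc`, dag-n15-w5 `hasMaj_idef_comp_mmulOp_loc`, lit `idef_add`, `idef_sub`.  Nothing in the tree is modified.

WHY.  Entry 2 of [B9] (3.42) is `𝒢∘∇^{U*}`; on the lattice the adjoint covariant derivative in direction `μ` has the SPECIES SHAPE `M_{R_μ}∘∇^−_μ + M_{B_μ}` (transport matrix `R_μ`, connection part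
`B_μ = η⁻¹(R_μ − 1)`; n15-c `covD` = `mmulOp R ∘ fdiffN + mmulOp (η⁻¹(R − 1))`).  FILE 149 (and FILE 158, its output-localized edition) read the right entry ONLY through the sandwich
`(M_{χ_□}G_□)∘E∘M_{h^s_□} = T₂,□∘M_{h^s_□}` plus `T₂`'s two-sided row and two-grid defect.  FILE 153 §1 gave the pure-gradient sandwich of the adjoint-side cube `X°`; THIS FILE pushes the
matrix multiplier through the gradient (FILE 150's product rules) so that the covariant-shaped entry is sandwiched too, sums the directions, produces the cut form, and books `T₂`'s row and
η-defect from letters already in the kit (rows `β` of `G`, `β_T` of `T^±`, defects `m, m_T`, coefficient row sums `r_R, r_{∇R}, r_B` and fits `o_R, o_{∇R}, o_B`).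

WHAT.  §1 `sandwich_add`, `sandwich_sum`, `cut_sandwich_of_sandwich`, ★ `comp_covShape_fgrad_sandwich`, ★ `comp_covShape_bgrad_sandwich`; §2 ★ `hasMaj_covShapeEntry_loc₂`
(`T₂ ≤ 1_S1_S·(β_Tr_R + βr_{∇R} + βr_B)e^{−δd}`), ★★ `hasMaj_idef_covShapeEntry_loc₂` (`𝔇(T₂′, T₂) ≤ 1_S1_S·[(β_To_R + m_Tr_R) + (βo_{∇R} + mr_{∇R}) + (βo_B + mr_B)]e^{−δd}`); §3 ★★
`smoothCutDressed_comp_covShape_fgrad∕bgrad_sandwich` — the instance `G := X°`, `T^± := Ñ_𝒲∘M_χ̃∘T^±_N` (FILE 153 §1).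

HONEST FRAMING ∕ LIMITS.  Lattice Leibniz + block-majorant bookkeeping over DISPLAYED letters; proves NO estimate of any concrete propagator; nothing of [B5]∕[B6]∕[B9] asserted ((3.42) p.397 entry
2, (3.64)–(3.65) pp.402–403, (2.133)–(2.134) p.247 = SHAPES; Thm 3.14 pp.426–427 = difference TEMPLATE).  NE2⁺ NOT PRINTED, NOT proved; N15 NOT discharged; K3⁸ OPEN, skeleton v7 untouched
(0∕2); counts of record UNMOVED by this seat (typed 28∕28 · discharged 7∕28 = 7∕27 excl. NODE O, №245); one finite 𝕋⁴ at fixed ε — NOT infinite volume, NOT OS on ℝ⁴, NOT a mass gap, NOT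
Clay; R4 closes the conditional finite-𝕋⁴ rung `BalabanLadder.UV` only.  Restate-immune (no Theses import).
-/

set_option autoImplicit false

noncomputable section
open scoped BigOperators

namespace Summit.QuantumFields.YangMills.BalabanUVNodes.N15.Gluing

open Literature.MathematicalPhysics.QuantumFieldTheory.Balaban1983to89
open Literature.MathematicalPhysics.QuantumFieldTheory.Balaban1983to89.B11SectG (BlockNorm HasMaj RowSum)
open Literature.MathematicalPhysics.QuantumFieldTheory.Balaban1983to89.T4EtaRateDefect (idef idef_add idef_sub)
open Literature.MathematicalPhysics.QuantumFieldTheory.Balaban1983to89.T4EtaRateCoeffDefect (pull)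
open Literature.MathematicalPhysics.QuantumFieldTheory.Balaban1983to89.B6Prop26Gluing (mulOp mulOp_apply ind ind_nonneg)
open Summit.QuantumFields.YangMills.BalabanUVNodes.N15.MatrixSpecies (mmulOp liftBlk liftMap liftEquiv)
open Summit.QuantumFields.YangMills.BalabanUVNodes.N15.BackgroundLayer (fgrad bgrad stack projO unstackM bgPropV fgradMat)
open Summit.QuantumFields.YangMills.BalabanUVNodes.N15.CurvedSpecies (mmulOp_comp_mulOp_fst hasMaj_comp_mmulOp_loc hasMaj_idef_comp_mmulOp_loc)

/-! ## §1 Sandwich algebra: sums, the cut form, the covariant shape -/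

section Algebra

variable {X ι : Type} [Fintype ι] [DecidableEq ι]

omit [Fintype ι] [DecidableEq ι] in
/-- sandwiches add: `G∘Q₁∘M = T₁∘M`, `G∘Q₂∘M = T₂∘M` ⟹ `G∘(Q₁ + Q₂)∘M = (T₁ + T₂)∘M`. [folklore] -/
theorem sandwich_add {G Q₁ Q₂ T₁ T₂ M : (X × ι → ℝ) →ₗ[ℝ] (X × ι → ℝ)} (h₁ : G ∘ₗ Q₁ ∘ₗ M = T₁ ∘ₗ M) (h₂ : G ∘ₗ Q₂ ∘ₗ M = T₂ ∘ₗ M) :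
    G ∘ₗ (Q₁ + Q₂) ∘ₗ M = (T₁ + T₂) ∘ₗ M := by
  rw [LinearMap.add_comp, LinearMap.comp_add, h₁, h₂, LinearMap.add_comp]

omit [Fintype ι] [DecidableEq ι] in
/-- sandwiches sum over directions: `G∘Q_k∘M = T_k∘M` for `k ∈ s` ⟹ `G∘(Σ_{k∈s}Q_k)∘M = (Σ_{k∈s}T_k)∘M`. [folklore] -/
theorem sandwich_sum {K : Type} [DecidableEq K] (s : Finset K) {G M : (X × ι → ℝ) →ₗ[ℝ] (X × ι → ℝ)} {Q T : K → (X × ι → ℝ) →ₗ[ℝ] (X × ι → ℝ)}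
    (h : ∀ k ∈ s, G ∘ₗ Q k ∘ₗ M = T k ∘ₗ M) : G ∘ₗ (∑ k ∈ s, Q k) ∘ₗ M = (∑ k ∈ s, T k) ∘ₗ M := by
  induction s using Finset.induction_on with
  | empty => simp
  | @insert k s hk ih =>
    rw [Finset.sum_insert hk, Finset.sum_insert hk]
    exact sandwich_add (h k (Finset.mem_insert_self k s)) (ih fun k' hk' => h k' (Finset.mem_insert_of_mem hk'))

omit [Fintype ι] [DecidableEq ι] in
/-- THE CUT FORM FILE 149∕158 CONSUME: `G∘E∘M_χ = T∘M_χ`, `χ = 1` on `supp a` ⟹ `M_c∘G∘E∘M_a = (M_c∘T)∘M_a` for any left multiplier `c` (FILE 153 `comp_mulOp_of_sandwich`).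
[cite: Balaban1984PropagatorsII, (2.133) p.247 (shape)] -/
theorem cut_sandwich_of_sandwich {χX : X → ℝ} {G E T : (X × ι → ℝ) →ₗ[ℝ] (X × ι → ℝ)} {a c : X × ι → ℝ}
    (hs : G ∘ₗ E ∘ₗ mulOp (fun p : X × ι => χX p.1) = T ∘ₗ mulOp (fun p : X × ι => χX p.1)) (ha : ∀ p, a p ≠ 0 → χX p.1 = 1) :
    mulOp c ∘ₗ G ∘ₗ E ∘ₗ mulOp a = (mulOp c ∘ₗ T) ∘ₗ mulOp a := by
  rw [comp_mulOp_of_sandwich hs ha, LinearMap.comp_assoc]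

variable {χX : X → ℝ}

omit [DecidableEq ι] in
/-- ★ **THE COVARIANT-SHAPED FORWARD ENTRY IS SANDWICHED**: `G∘∇⁺∘M_χ = T∘M_χ` ⟹ `G∘(M_R∇⁺ + M_B)∘M_χ = (T∘M_{R∘e⁻¹} − G∘M_{(∇R)∘e⁻¹} + G∘M_B)∘M_χ` (FILE 150 `comp_species_fgrad_sandwich`: the
multiplier moves through the gradient by the lattice product rule). [cite: Balaban1985BackgroundPropagators, (3.42) p.397 (entry 2: shape), (3.64)–(3.65) pp.402–403; Balaban1984PropagatorsII, (2.133) p.247] -/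
theorem comp_covShape_fgrad_sandwich (n : ℝ) (e : X ≃ X) (R B : X → Matrix ι ι ℝ) {G T : (X × ι → ℝ) →ₗ[ℝ] (X × ι → ℝ)}
    (hT : G ∘ₗ fgrad n (liftEquiv e ι) ∘ₗ mulOp (fun p : X × ι => χX p.1) = T ∘ₗ mulOp (fun p : X × ι => χX p.1)) :
    G ∘ₗ (mmulOp R ∘ₗ fgrad n (liftEquiv e ι) + mmulOp B) ∘ₗ mulOp (fun p : X × ι => χX p.1) =
      (T ∘ₗ mmulOp (R ∘ e.symm) - G ∘ₗ mmulOp (fgradMat n e R ∘ e.symm) + G ∘ₗ mmulOp B) ∘ₗ mulOp (fun p : X × ι => χX p.1) := by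
  rw [LinearMap.add_comp, LinearMap.comp_add, comp_species_fgrad_sandwich n e R hT]
  simp only [LinearMap.add_comp, LinearMap.sub_comp, LinearMap.comp_assoc, mmulOp_comp_mulOp_fst]

omit [DecidableEq ι] in
/-- ★ **THE COVARIANT-SHAPED BACKWARD ENTRY IS SANDWICHED** (the print's `∇^{U*}_μ`): `G∘∇⁻∘M_χ = T∘M_χ` ⟹ `G∘(M_R∇⁻ + M_B)∘M_χ = (T∘M_{R∘e} − G∘M_{∇R} + G∘M_B)∘M_χ` (FILE 150
`comp_species_bgrad_sandwich`). [cite: Balaban1985BackgroundPropagators, (3.42) p.397 (entry 2: shape), (3.64)–(3.65) pp.402–403; Balaban1984PropagatorsII, (2.133) p.247] -/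
theorem comp_covShape_bgrad_sandwich (n : ℝ) (e : X ≃ X) (R B : X → Matrix ι ι ℝ) {G T : (X × ι → ℝ) →ₗ[ℝ] (X × ι → ℝ)}
    (hT : G ∘ₗ bgrad n (liftEquiv e ι) ∘ₗ mulOp (fun p : X × ι => χX p.1) = T ∘ₗ mulOp (fun p : X × ι => χX p.1)) :
    G ∘ₗ (mmulOp R ∘ₗ bgrad n (liftEquiv e ι) + mmulOp B) ∘ₗ mulOp (fun p : X × ι => χX p.1) =
      (T ∘ₗ mmulOp (R ∘ e) - G ∘ₗ mmulOp (fgradMat n e R) + G ∘ₗ mmulOp B) ∘ₗ mulOp (fun p : X × ι => χX p.1) := by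
  rw [LinearMap.add_comp, LinearMap.comp_add, comp_species_bgrad_sandwich n e R hT]
  simp only [LinearMap.add_comp, LinearMap.sub_comp, LinearMap.comp_assoc, mmulOp_comp_mulOp_fst]

end Algebra

/-! ## §2 The sandwiched covariant entry's two-sided row and two-grid η-defect -/

section Rows

variable {X X' ι : Type} [Fintype X] [Fintype X'] [Fintype ι] [DecidableEq ι] {g : B6.Geometry} (blk : X → g.Site) (π : X' → X)

omit [Fintype X'] [DecidableEq ι] in
/-- ★ **THE ROW**: `G ≤ 1_S1_S·βe^{−δd}`, `T ≤ 1_S1_S·β_Te^{−δd}`, coefficient row sums `r_R, r_{∇R}, r_B` ⟹ `T∘M_R − G∘M_{R′} + G∘M_B ≤ 1_S1_S·(β_Tr_R + βr_{∇R} + βr_B)e^{−δd}` (dag-n15-w3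
`hasMaj_comp_mmulOp_loc`, thrice). [cite: Balaban1984PropagatorsII, (2.133) p.247 (shape); Balaban1985BackgroundPropagators, (3.42) p.397] -/
theorem hasMaj_covShapeEntry_loc₂ {G T : (X × ι → ℝ) →ₗ[ℝ] (X × ι → ℝ)} {R R' B : X → Matrix ι ι ℝ} {S : Set g.Site} {β βT rR rR' rB δ : ℝ} (hβ : 0 ≤ β) (hβT : 0 ≤ βT)
    (hrR : 0 ≤ rR) (hrR' : 0 ≤ rR') (hrB : 0 ≤ rB) (hR : ∀ x i, ∑ k, |R x i k| ≤ rR) (hR' : ∀ x i, ∑ k, |R' x i k| ≤ rR') (hB : ∀ x i, ∑ k, |B x i k| ≤ rB)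
    (hG : HasMaj (BlockNorm.ofBlocks g (liftBlk blk ι)) (BlockNorm.ofBlocks g (liftBlk blk ι)) G (fun y y' => ind S y * ind S y' * (β * Real.exp (-(δ * g.dist y y')))))
    (hTr : HasMaj (BlockNorm.ofBlocks g (liftBlk blk ι)) (BlockNorm.ofBlocks g (liftBlk blk ι)) T (fun y y' => ind S y * ind S y' * (βT * Real.exp (-(δ * g.dist y y'))))) :
    HasMaj (BlockNorm.ofBlocks g (liftBlk blk ι)) (BlockNorm.ofBlocks g (liftBlk blk ι)) (T ∘ₗ mmulOp R - G ∘ₗ mmulOp R' + G ∘ₗ mmulOp B)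
      (fun y y' => ind S y * ind S y' * ((βT * rR + β * rR' + β * rB) * Real.exp (-(δ * g.dist y y')))) := by
  refine (((hasMaj_comp_mmulOp_loc blk hβT hrR hR hTr).sub (hasMaj_comp_mmulOp_loc blk hβ hrR' hR' hG)).add (hasMaj_comp_mmulOp_loc blk hβ hrB hB hG)).mono
    fun y y' => le_of_eq ?_
  ring

omit [DecidableEq ι] in
/-- ★★ **THE TWO-GRID η-DEFECT**: fine rows `G′ ≤ 1_S1_S·β`, `T′ ≤ 1_S1_S·β_T`, defects `𝔇(G′,G) ≤ 1_S1_S·m`, `𝔇(T′,T) ≤ 1_S1_S·m_T` (rate `δ`), coarse coefficient row sums `r_R, r_{∇R}, r_B` and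
row fits `o_R, o_{∇R}, o_B` across `π` ⟹ `𝔇(T′∘M_{R_f} − G′∘M_{R′_f} + G′∘M_{B_f}, T∘M_R − G∘M_{R′} + G∘M_B) ≤ 1_S1_S·[(β_To_R + m_Tr_R) + (βo_{∇R} + mr_{∇R}) + (βo_B + mr_B)]e^{−δd}`
(dag-n15-w5 `hasMaj_idef_comp_mmulOp_loc`, thrice). [cite: Balaban1985BackgroundPropagators, Thm 3.14 pp.426–427 (difference template); Balaban1984PropagatorsII, (2.133) p.247 (shape)] -/
theorem hasMaj_idef_covShapeEntry_loc₂ {G T : (X × ι → ℝ) →ₗ[ℝ] (X × ι → ℝ)} {G' T' : (X' × ι → ℝ) →ₗ[ℝ] (X' × ι → ℝ)} {R R' B : X → Matrix ι ι ℝ} {Rf Rf' Bf : X' → Matrix ι ι ℝ}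
    {S : Set g.Site} {β βT m mT rR rR' rB oR oR' oB δ : ℝ} (hβ : 0 ≤ β) (hβT : 0 ≤ βT) (hm : 0 ≤ m) (hmT : 0 ≤ mT) (hrR : 0 ≤ rR) (hrR' : 0 ≤ rR') (hrB : 0 ≤ rB) (hoR : 0 ≤ oR)
    (hoR' : 0 ≤ oR') (hoB : 0 ≤ oB) (hR : ∀ x i, ∑ k, |R x i k| ≤ rR) (hR' : ∀ x i, ∑ k, |R' x i k| ≤ rR') (hB : ∀ x i, ∑ k, |B x i k| ≤ rB)
    (hfR : ∀ x' i, ∑ k, |Rf x' i k - R (π x') i k| ≤ oR) (hfR' : ∀ x' i, ∑ k, |Rf' x' i k - R' (π x') i k| ≤ oR') (hfB : ∀ x' i, ∑ k, |Bf x' i k - B (π x') i k| ≤ oB)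
    (hG' : HasMaj (BlockNorm.ofBlocks g (liftBlk (blk ∘ π) ι)) (BlockNorm.ofBlocks g (liftBlk (blk ∘ π) ι)) G' (fun y y' => ind S y * ind S y' * (β * Real.exp (-(δ * g.dist y y')))))
    (hT' : HasMaj (BlockNorm.ofBlocks g (liftBlk (blk ∘ π) ι)) (BlockNorm.ofBlocks g (liftBlk (blk ∘ π) ι)) T' (fun y y' => ind S y * ind S y' * (βT * Real.exp (-(δ * g.dist y y')))))
    (hDG : HasMaj (BlockNorm.ofBlocks g (liftBlk blk ι)) (BlockNorm.ofBlocks g (liftBlk (blk ∘ π) ι)) (idef (pull (liftMap π ι)) (pull (liftMap π ι)) G' G)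
      (fun y y' => ind S y * ind S y' * (m * Real.exp (-(δ * g.dist y y')))))
    (hDT : HasMaj (BlockNorm.ofBlocks g (liftBlk blk ι)) (BlockNorm.ofBlocks g (liftBlk (blk ∘ π) ι)) (idef (pull (liftMap π ι)) (pull (liftMap π ι)) T' T)
      (fun y y' => ind S y * ind S y' * (mT * Real.exp (-(δ * g.dist y y'))))) :
    HasMaj (BlockNorm.ofBlocks g (liftBlk blk ι)) (BlockNorm.ofBlocks g (liftBlk (blk ∘ π) ι))
      (idef (pull (liftMap π ι)) (pull (liftMap π ι)) (T' ∘ₗ mmulOp Rf - G' ∘ₗ mmulOp Rf' + G' ∘ₗ mmulOp Bf) (T ∘ₗ mmulOp R - G ∘ₗ mmulOp R' + G ∘ₗ mmulOp B))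
      (fun y y' => ind S y * ind S y' * ((((βT * oR + mT * rR) + (β * oR' + m * rR')) + (β * oB + m * rB)) * Real.exp (-(δ * g.dist y y')))) := by
  rw [idef_add, idef_sub]
  refine (((hasMaj_idef_comp_mmulOp_loc blk π hβT hoR hmT hrR hR hfR hT' hDT).sub (hasMaj_idef_comp_mmulOp_loc blk π hβ hoR' hm hrR' hR' hfR' hG' hDG)).add
    (hasMaj_idef_comp_mmulOp_loc blk π hβ hoB hm hrB hB hfB hG' hDG)).mono fun y y' => le_of_eq ?_
  ring

end Rows

/-! ## §3 The instance: the adjoint-side dressed smooth-cut cube -/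

section Instance

variable {X ι J : Type} [Fintype X] [DecidableEq X] [Fintype ι] [DecidableEq ι] [Fintype J] [DecidableEq J] (τ : J → X ≃ X) (n : ℝ)
  {N : (X × ι → ℝ) →ₗ[ℝ] (X × ι → ℝ)} {χX χtX : X → ℝ}

/-- ★★ **THE ADJOINT-SIDE DRESSED CUBE's COVARIANT-SHAPED FORWARD ENTRY IS SANDWICHED**: `X°∘(M_R∇⁺_e + M_B)∘M_χ = ((Ñ_𝒲∘M_χ̃∘T)∘M_{R∘e⁻¹} − X°∘M_{(∇R)∘e⁻¹} + X°∘M_B)∘M_χ` from the flat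
cube's sandwich `N∘∇⁺_e∘M_χ = T∘M_χ` (FILE 153 `smoothCutDressed_comp_grad_sandwich` + ★ `comp_covShape_fgrad_sandwich`). [cite: Balaban1985BackgroundPropagators, (3.42) p.397 (entry 2: shape), (3.64)–(3.65) pp.402–403] -/
theorem smoothCutDressed_comp_covShape_fgrad_sandwich {D : J ⊕ J → (X × ι → ℝ) →ₗ[ℝ] (X × ι → ℝ)} {V : ((X × ι) × Option (J ⊕ J) → ℝ) →ₗ[ℝ] (X × ι → ℝ)}
    (hD : ∀ j, D j = (fun j => Sum.elim (fun μ => fgrad n (liftEquiv (τ μ) ι)) (fun μ => bgrad n (liftEquiv (τ μ) ι)) j) j ∘ₗ (mulOp (fun p : X × ι => χtX p.1) ∘ₗ N))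
    (hunit : IsUnit (1 - LinearMap.toMatrix' (stack (mulOp (fun p : X × ι => χtX p.1) ∘ₗ N) D ∘ₗ V)))
    (hχ : mulOp (fun p : X × ι => χX p.1) ∘ₗ mulOp (fun p : X × ι => χtX p.1) = mulOp (fun p : X × ι => χtX p.1))
    (hunitW : IsUnit (1 - LinearMap.toMatrix' ((mulOp (fun p : X × ι => χtX p.1) ∘ₗ N) ∘ₗ V ∘ₗ
      stack LinearMap.id (fun j => Sum.elim (fun μ => fgrad n (liftEquiv (τ μ) ι)) (fun μ => bgrad n (liftEquiv (τ μ) ι)) j) ∘ₗ mulOp (fun p : X × ι => χX p.1))))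
    (e : X ≃ X) (R B : X → Matrix ι ι ℝ) {T : (X × ι → ℝ) →ₗ[ℝ] (X × ι → ℝ)} (hT : N ∘ₗ fgrad n (liftEquiv e ι) ∘ₗ mulOp (fun p : X × ι => χX p.1) = T ∘ₗ mulOp (fun p : X × ι => χX p.1)) :
    (projO none ∘ₗ bgPropV (stack (mulOp (fun p : X × ι => χtX p.1) ∘ₗ N) D) V) ∘ₗ (mmulOp R ∘ₗ fgrad n (liftEquiv e ι) + mmulOp B) ∘ₗ mulOp (fun p : X × ι => χX p.1) =
      ((neumannR ((mulOp (fun p : X × ι => χtX p.1) ∘ₗ N) ∘ₗ V ∘ₗ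
            stack LinearMap.id (fun j => Sum.elim (fun μ => fgrad n (liftEquiv (τ μ) ι)) (fun μ => bgrad n (liftEquiv (τ μ) ι)) j) ∘ₗ mulOp (fun p : X × ι => χX p.1)) ∘ₗ
          (mulOp (fun p : X × ι => χtX p.1) ∘ₗ T)) ∘ₗ mmulOp (R ∘ e.symm) -
        (projO none ∘ₗ bgPropV (stack (mulOp (fun p : X × ι => χtX p.1) ∘ₗ N) D) V) ∘ₗ mmulOp (fgradMat n e R ∘ e.symm) +
        (projO none ∘ₗ bgPropV (stack (mulOp (fun p : X × ι => χtX p.1) ∘ₗ N) D) V) ∘ₗ mmulOp B) ∘ₗ mulOp (fun p : X × ι => χX p.1) :=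
  comp_covShape_fgrad_sandwich n e R B (smoothCutDressed_comp_grad_sandwich τ n hD hunit hχ hunitW hT)

/-- ★★ **THE ADJOINT-SIDE DRESSED CUBE's COVARIANT-SHAPED BACKWARD ENTRY IS SANDWICHED** (the print's `𝒢∘∇^{U*}_μ` per cube): `X°∘(M_R∇⁻_e + M_B)∘M_χ = ((Ñ_𝒲∘M_χ̃∘T)∘M_{R∘e} − X°∘M_{∇R} +
X°∘M_B)∘M_χ` from `N∘∇⁻_e∘M_χ = T∘M_χ`. [cite: Balaban1985BackgroundPropagators, (3.42) p.397 (entry 2: shape), (3.64)–(3.65) pp.402–403] -/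
theorem smoothCutDressed_comp_covShape_bgrad_sandwich {D : J ⊕ J → (X × ι → ℝ) →ₗ[ℝ] (X × ι → ℝ)} {V : ((X × ι) × Option (J ⊕ J) → ℝ) →ₗ[ℝ] (X × ι → ℝ)}
    (hD : ∀ j, D j = (fun j => Sum.elim (fun μ => fgrad n (liftEquiv (τ μ) ι)) (fun μ => bgrad n (liftEquiv (τ μ) ι)) j) j ∘ₗ (mulOp (fun p : X × ι => χtX p.1) ∘ₗ N))
    (hunit : IsUnit (1 - LinearMap.toMatrix' (stack (mulOp (fun p : X × ι => χtX p.1) ∘ₗ N) D ∘ₗ V)))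
    (hχ : mulOp (fun p : X × ι => χX p.1) ∘ₗ mulOp (fun p : X × ι => χtX p.1) = mulOp (fun p : X × ι => χtX p.1))
    (hunitW : IsUnit (1 - LinearMap.toMatrix' ((mulOp (fun p : X × ι => χtX p.1) ∘ₗ N) ∘ₗ V ∘ₗ
      stack LinearMap.id (fun j => Sum.elim (fun μ => fgrad n (liftEquiv (τ μ) ι)) (fun μ => bgrad n (liftEquiv (τ μ) ι)) j) ∘ₗ mulOp (fun p : X × ι => χX p.1))))
    (e : X ≃ X) (R B : X → Matrix ι ι ℝ) {T : (X × ι → ℝ) →ₗ[ℝ] (X × ι → ℝ)} (hT : N ∘ₗ bgrad n (liftEquiv e ι) ∘ₗ mulOp (fun p : X × ι => χX p.1) = T ∘ₗ mulOp (fun p : X × ι => χX p.1)) :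
    (projO none ∘ₗ bgPropV (stack (mulOp (fun p : X × ι => χtX p.1) ∘ₗ N) D) V) ∘ₗ (mmulOp R ∘ₗ bgrad n (liftEquiv e ι) + mmulOp B) ∘ₗ mulOp (fun p : X × ι => χX p.1) =
      ((neumannR ((mulOp (fun p : X × ι => χtX p.1) ∘ₗ N) ∘ₗ V ∘ₗ
            stack LinearMap.id (fun j => Sum.elim (fun μ => fgrad n (liftEquiv (τ μ) ι)) (fun μ => bgrad n (liftEquiv (τ μ) ι)) j) ∘ₗ mulOp (fun p : X × ι => χX p.1)) ∘ₗ
          (mulOp (fun p : X × ι => χtX p.1) ∘ₗ T)) ∘ₗ mmulOp (R ∘ e) -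
        (projO none ∘ₗ bgPropV (stack (mulOp (fun p : X × ι => χtX p.1) ∘ₗ N) D) V) ∘ₗ mmulOp (fgradMat n e R) +
        (projO none ∘ₗ bgPropV (stack (mulOp (fun p : X × ι => χtX p.1) ∘ₗ N) D) V) ∘ₗ mmulOp B) ∘ₗ mulOp (fun p : X × ι => χX p.1) :=
  comp_covShape_bgrad_sandwich n e R B (smoothCutDressed_comp_grad_sandwich τ n hD hunit hχ hunitW hT)

end Instance

end Summit.QuantumFields.YangMills.BalabanUVNodes.N15.Gluing

end
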